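import Literature.Geometry.Symplectic.PALFFibreCollarLevels
import Literature.Geometry.Symplectic.PALFBoundaryFibres
import Literature.Geometry.Symplectic.PALFKasCount
import HarnessLib

/-!
# The ends of the regular fibre of a Lefschetz fibration over the disc: level sets of the
# collar coordinate versus the binding

Topic `Literature/Geometry/Symplectic` (fact seat
`provefact-Literature.Geometry.Symplectic.Oba2016_s-add47373d4`; assembly of the bricks
`PALFFibreCollarLevels.lean` and `PALFBoundaryFibres.lean` toward the fibre-page statement `hF`
of `kasHandleCount_of_planarFibreMorse`, Kas 1980 §2).  For a PALF `P`, flow-out data `D`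
(collar coordinate `σ = D.f`, `τ = σ ∘ incl` on the interior `F°(c₀)` of the regular fibre over
`c₀`, `‖c₀‖ < 1`) there is `t₀ > 0` such that for `0 < t ≤ t₀` the level `{τ = t}` of `F°(c₀)`
is homeomorphic to the binding of the boundary open book; in particular it has
`Nat.card (ConnectedComponents P.ob.binding)` connected components — the number `n + 1` of
the handle count `hK`.

* `PALF.nonempty_homeomorph_tauLevel_fibreLevel` —
  `{q ∈ F°(c₀) | τ q = t} ≃ₜ {x ∈ W | f x = c₀ ∧ σ x = t}` for `t > 0` (points of positive collar
  coordinate are interior);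
* `PALF.exists_forall_nonempty_homeomorph_tauLevel_binding`,
  `PALF.exists_forall_natCard_connectedComponents_tauLevel`.

Everything is proved; no definitions, no named facts.

## References

* A. Kas, *On the handlebody decomposition associated to a Lefschetz fibration*, Pacific J.
  Math. 89 (1980), §2. [Kas1980]
-/

open scoped Manifold ContDiff Topology
open Set Function Filter

noncomputable section

namespace Literature.Geometry.Symplectic

open Literature.Topology.FourManifolds

universe u

variable {W : Type u} [TopologicalSpace W] [T2Space W] [SecondCountableTopology W]
  [ChartedSpace (EuclideanHalfSpace 4) W] [IsManifold (𝓡∂ 4) ∞ W] [CompactSpace W]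
  {o : SmoothOrientation (𝓡∂ 4) W} {b : BoundaryData (𝓡∂ 4) W (𝓡 3)}

namespace PALF

omit [T2Space W] [SecondCountableTopology W] [CompactSpace W] in
/-- A positive level of the collar coordinate on the interior of the regular fibre is the same
space as the corresponding level in the whole fibre (its points are interior). [folklore] -/
theorem nonempty_homeomorph_tauLevel_fibreLevel (P : PALF o b) (D : FlowoutInput 3 W)
    {c₀ : EuclideanSpace ℝ (Fin 2)} (hc : c₀ ∉ P.f '' ↑P.crit) {t : ℝ} (ht : 0 < t) :
    Nonempty ({q : RegularFibreOn (P.isRegularFibreOn_interior hc) //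
        D.f (RegularFibreOn.incl (P.isRegularFibreOn_interior hc) q) = t} ≃ₜ
      {x : W // P.f x = c₀ ∧ D.f x = t}) := by
  set hF := P.isRegularFibreOn_interior hc
  have hint : ∀ x : {x : W // P.f x = c₀ ∧ D.f x = t}, (𝓡∂ 4).IsInteriorPoint x.1 := fun x =>
    isInteriorPoint_of_flowout_pos D (by rw [x.2.2]; exact ht)
  let g : {x : W // P.f x = c₀ ∧ D.f x = t} →
      {q : RegularFibreOn hF // D.f (RegularFibreOn.incl hF q) = t} :=
    fun x => ⟨⟨x.1, x.2.1, hint x⟩, x.2.2⟩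
  have hg : Continuous g :=
    ((continuous_subtype_val.subtype_mk _).subtype_mk _)
  refine ⟨{ toFun := fun q => ⟨q.1.1, q.1.2.1, q.2⟩
            invFun := g
            left_inv := fun q => rfl
            right_inv := fun x => rfl
            continuous_toFun := ?_
            continuous_invFun := hg }⟩
  exact (continuous_subtype_val.comp continuous_subtype_val).subtype_mk _

/-- **The ends of the regular fibre: `{τ = t} ≃ₜ B` for small `t > 0`** (Kas 1980, §2).  For a
PALF `P`, flow-out data `D` and a regular value `c₀` with `‖c₀‖ < 1` there is `t₀ > 0` such that
for `0 < t ≤ t₀` the level `{τ = t}` of the collar coordinate on `F°(c₀)` is homeomorphic to the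
binding of the boundary open book (`nonempty_homeomorph_fibreLevel_boundaryLevel` and
`nonempty_homeomorph_boundaryLevel_binding`). [cite: Kas1980, §2] -/
theorem exists_forall_nonempty_homeomorph_tauLevel_binding (P : PALF o b) (D : FlowoutInput 3 W)
    {c₀ : EuclideanSpace ℝ (Fin 2)} (hc₀ : ‖c₀‖ < 1) (hc : c₀ ∉ P.f '' ↑P.crit) :
    ∃ t₀ : ℝ, 0 < t₀ ∧ ∀ t ∈ Ioc 0 t₀,
      Nonempty ({q : RegularFibreOn (P.isRegularFibreOn_interior hc) //
          D.f (RegularFibreOn.incl (P.isRegularFibreOn_interior hc) q) = t} ≃ₜ P.ob.binding) := by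
  obtain ⟨t₀, ht₀, h⟩ := P.nonempty_homeomorph_fibreLevel_boundaryLevel D hc₀
  obtain ⟨e₃⟩ := P.nonempty_homeomorph_boundaryLevel_binding hc₀
  refine ⟨t₀, ht₀, fun t ht => ?_⟩
  obtain ⟨e₁⟩ := P.nonempty_homeomorph_tauLevel_fibreLevel D hc ht.1
  obtain ⟨e₂⟩ := h t ht
  exact ⟨e₁.trans (e₂.trans e₃)⟩

/-- **The ends of the regular fibre have as many components as the binding**: for small `t > 0`,
`Nat.card (ConnectedComponents {τ = t}) = Nat.card (ConnectedComponents P.ob.binding)` — the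
number `n + 1` of Kas' handle count. [cite: Kas1980, §2] -/
theorem exists_forall_natCard_connectedComponents_tauLevel (P : PALF o b) (D : FlowoutInput 3 W)
    {c₀ : EuclideanSpace ℝ (Fin 2)} (hc₀ : ‖c₀‖ < 1) (hc : c₀ ∉ P.f '' ↑P.crit) :
    ∃ t₀ : ℝ, 0 < t₀ ∧ ∀ t ∈ Ioc 0 t₀,
      Nat.card (ConnectedComponents {q : RegularFibreOn (P.isRegularFibreOn_interior hc) //
          D.f (RegularFibreOn.incl (P.isRegularFibreOn_interior hc) q) = t}) =
        Nat.card (ConnectedComponents P.ob.binding) := by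
  obtain ⟨t₀, ht₀, h⟩ := P.exists_forall_nonempty_homeomorph_tauLevel_binding D hc₀ hc
  refine ⟨t₀, ht₀, fun t ht => ?_⟩
  obtain ⟨e⟩ := h t ht
  exact natCard_connectedComponents_congr e

end PALF

end Literature.Geometry.Symplectic

end
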